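import Summits.QuantumFields.BalabanUV.Beta.WardBorderWardModel

/-!
# `BalabanUV.Beta.WardBorderWardModelClass` — binder row D1, (L4): the `LocStencil₂` CLASS of the two-slot border Ward model `TB`
# (β sub-cell, D1 formalisation swarm, unit `b2b-balaban-beta-d1-formalise-leaf-06`, gen 5; «D1-hRhW-BORDER-JOINT-WARD-MODEL» part D1, class half)

HONEST FRAMING (cell charter, verbatim): «discharging `BetaPertH` makes Bałaban's UV stability UNCONDITIONAL — a real constructive-QFT
result; it is NOT the continuum limit and NOT the Clay problem.»  HONEST DEPENDENCY (verbatim): «continuum YM on T⁴ ⇐ BetaPertH ∧ nine spine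
estimates (0/9 proved); BetaPertH ⇐ (D1) ∧ (D4) ∧ CAP+tail; G-an2-4 gates asym, D1 and NE2/3/4.»  [folklore] `ℓ¹`-bookkeeping over node 7aρ's class
`locStencil_vhSAt`, the border dictionary `WardLocusStencils.bhKAt_inl_inr_eq_linSymAt`∕`_inr_inl_…` with an2's `decays_bhKAt`, and part D1's path
support `l1_le_of_spath_ne_zero` BY NAME.  No statement of Bałaban's papers, no `[cite:]`, no `def`; `TB` is a MODEL of a typed socket, NOT Bałaban's
second-order border averaging jet; instantiates NO binder of the β-function wall (0/4: hW, hR, D1Tel, D1Rep).  NOT hW, NOT hR, NOT D1, NOT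
`BetaPertH`, NOT continuum, NOT Clay.

WHAT (`d + 1 = 4`, in-block root `ρ = toSite r`, `r ∈ box 4 Lc`, `Lc ≥ 1`): **`locStencil₂_TB : ∃ C δ, 0 < δ ∧ LocStencil₂ (TB (toSite r) Lc c′) C δ`**
(rate `1∕8`) — on the support of the entry flux both jet bonds lie within `2|z − x|₁ + 5|ρ|₁` of `x` (`l1_sub_le_of_spath_ne_zero`), `vhSAt` is a local
stencil at rate `1`, the charge kernel `mfNeg (linSymAt ρ Lc)` decays at every rate (`abs_mfNeg_linSymAt_le`), and the triangle inequality trades the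
three localisations for `e^{−(|u′−u|₁ + |x−u|₁ + |z−u|₁)∕8}`; the real arithmetic is isolated in `entry_bound`.
Provenance: D1 formalisation swarm, leaf prover 06 (gen 5), 2026-08-20; no existing file touched.
-/

noncomputable section

open Finset
open scoped BigOperators
open Literature.MathematicalPhysics.QuantumFieldTheory
open Literature.MathematicalPhysics.QuantumFieldTheory.Balaban1983to89
open Literature.MathematicalPhysics.QuantumFieldTheory.Balaban1983to89.Beta
open B12Sec2to5 (l1 l1_nonneg)
open ExpKernelCalculus (MKer BiLoc l1_sub_triangle l1_sub_symm)
open AffineAveraging (Site box toSite)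
open AveragingHessianKernelsRooted (vhSAt locStencil_vhSAt)
open OneStepResolventKernel (Fib LocStencil)
open BalabanCompositeJets (LocStencil₂)
open StepJetData (mfNeg)
open Summit.QuantumFields.BalabanUV.Beta.TameKernelCalculus
open Summit.QuantumFields.BalabanUV.Beta.BorderedHessian (bhKAt decays_bhKAt cBHA cBHA_nonneg)
open Summit.QuantumFields.BalabanUV.Beta.AveragingWardRootedStencils (linSymAt linSymAt_inl_inl linSymAt_inr_inr legSite legSite_inl legSite_inr)
open Summit.QuantumFields.BalabanUV.Beta.WardLocusStencils (bhKAt_inl_inr_eq_linSymAt bhKAt_inr_inl_eq_linSymAt)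
open Summit.QuantumFields.BalabanUV.Beta.WardBorderWardModel

namespace Summit.QuantumFields.BalabanUV.Beta.WardBorderWardModelClass

/-! ## The `LocStencil₂` class of `TB` -/

section Class

variable {Lc : ℕ} {c' : ℝ}

/-- [folklore] A leg site is within `|ρ|₁` of its kernel index. -/
theorem l1_legSite_sub_le (ρ x : Fin (3 + 1) → ℤ) (a : Fib 3) : l1 (legSite ρ x a - x) ≤ l1 ρ := by
  rcases a with β | m
  · rw [legSite_inl, sub_self]
    have : l1 (0 : Fin (3 + 1) → ℤ) = 0 := by simp [l1]
    rw [this]; exact l1_nonneg ρ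
  · rw [legSite_inr, add_sub_cancel_left]

/-- [folklore] The two leg sites of an entry are within `|z − x|₁ + 2|ρ|₁` of each other. -/
theorem l1_legSite_sub_legSite_le (ρ x z : Fin (3 + 1) → ℤ) (a b : Fib 3) :
    l1 (legSite ρ z b - legSite ρ x a) ≤ l1 (z - x) + 2 * l1 ρ := by
  have h1 := l1_sub_triangle (legSite ρ z b) z (legSite ρ x a)
  have h2 := l1_sub_triangle z x (legSite ρ x a)
  have h3 := l1_legSite_sub_le ρ z b
  have h4 := l1_legSite_sub_le ρ x a
  rw [l1_sub_symm x] at h2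
  linarith

/-- [folklore] **SUPPORT OF THE ENTRY FLUX**: a bond on the flux between the leg sites of `(x,a;z,b)` is within `2|z − x|₁ + 5|ρ|₁` of `x`. -/
theorem l1_sub_le_of_spath_ne_zero {ρ x z u : Fin (3 + 1) → ℤ} {a b : Fib 3} {κ : Fin (3 + 1)}
    (h : spath (legSite ρ x a) (legSite ρ z b) κ u ≠ 0) : l1 (u - x) ≤ 2 * l1 (z - x) + 5 * l1 ρ := by
  have h1 := l1_le_of_spath_ne_zero h
  have h2 := l1_legSite_sub_legSite_le ρ x z a b
  have h3 := l1_sub_triangle u (legSite ρ x a) x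
  have h4 := l1_legSite_sub_le ρ x a
  linarith

/-- [folklore] **THE CHARGE KERNEL DECAYS** at every rate (the border dictionary `bhKAt = −Lc⁴·linSymAt` on the `fm` block, `+Lc⁴` on `mf`,
and an2's `decays_bhKAt`; `Lc ≥ 1`). -/
theorem abs_mfNeg_linSymAt_le (hLc : 1 ≤ Lc) {r : Fin (3 + 1) → ℕ} (hr : r ∈ box (3 + 1) Lc) {δ : ℝ} (hδ : 0 ≤ δ)
    (x z : Fin (3 + 1) → ℤ) (a b : Fib 3) :
    |mfNeg (linSymAt (toSite r) Lc) x z a b| ≤ cBHA 3 Lc * Real.exp (δ * (((3 : ℝ) + 1) * (2 * Lc))) * Real.exp (-δ * l1 (x - z)) := by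
  haveI : NeZero Lc := ⟨by omega⟩
  have hD := decays_bhKAt (d := 3) (N := Lc) hLc hr hδ x z a b
  have hL1 : (1 : ℝ) ≤ (Lc : ℝ) ^ (3 + 1) := by exact_mod_cast Nat.one_le_pow _ _ hLc
  have hL0 : (0 : ℝ) < (Lc : ℝ) ^ (3 + 1) := by positivity
  have hnn : 0 ≤ cBHA 3 Lc * Real.exp (δ * (((3 : ℝ) + 1) * (2 * Lc))) * Real.exp (-δ * l1 (x - z)) := (abs_nonneg _).trans hD
  -- `|linSymAt| ≤ |bhKAt|` on the border blocks
  have key : ∀ y : ℝ, |bhKAt 3 (toSite r) Lc x z a b| = (Lc : ℝ) ^ (3 + 1) * |y| → |y| ≤ |bhKAt 3 (toSite r) Lc x z a b| := by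
    intro y hy
    rw [hy]
    have := abs_nonneg y
    nlinarith
  rw [StepJetData.abs_mfNeg]
  rcases a with β | m <;> rcases b with β' | m'
  · rw [linSymAt_inl_inl, abs_zero]; exact hnn
  · refine (key _ ?_).trans hD
    rw [bhKAt_inl_inr_eq_linSymAt, abs_mul, abs_neg, abs_of_pos hL0]
  · refine (key _ ?_).trans hD
    rw [bhKAt_inr_inl_eq_linSymAt, abs_mul, abs_of_pos hL0]
  · rw [linSymAt_inr_inr, abs_zero]; exact hnn

/-- [folklore] Pure arithmetic of the three-term entry bound (kept separate so that no kernel definition is unfolded while estimating). -/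
theorem entry_bound {π π' W W' Q c L4 CV CQ K₁ K₂ t : ℝ} (hL4 : 0 ≤ L4) (hCV : 0 ≤ CV) (hCQ : 0 ≤ CQ) (hK : K₁ ≤ K₂) (hK₁ : 0 ≤ K₁)
    (ht : 0 ≤ t) (hπ1 : |π| ≤ 1) (hπ'1 : |π'| ≤ 1)
    (h1 : π ≠ 0 → |W'| ≤ CV * (K₁ * t)) (h2 : π' ≠ 0 → |W| ≤ CV * (K₁ * t)) (h3 : π ≠ 0 → π' ≠ 0 → |Q| ≤ CQ * (K₂ * t)) :
    |L4 * (π * (c * W') + c * W * π' - c * Q * π * π')| ≤ L4 * |c| * (2 * CV + CQ) * K₂ * t := by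
  have hc : 0 ≤ |c| := abs_nonneg c
  have hK₂ : 0 ≤ K₂ := hK₁.trans hK
  have n1 : 0 ≤ |c| * CV * K₁ * t := mul_nonneg (mul_nonneg (mul_nonneg hc hCV) hK₁) ht
  have n3 : 0 ≤ |c| * CQ * K₂ * t := mul_nonneg (mul_nonneg (mul_nonneg hc hCQ) hK₂) ht
  have t1 : |π * (c * W')| ≤ |c| * CV * K₁ * t := by
    by_cases h0 : π = 0
    · rw [h0, zero_mul, abs_zero]; exact n1
    rw [abs_mul, abs_mul]
    calc |π| * (|c| * |W'|) ≤ 1 * (|c| * (CV * (K₁ * t))) :=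
          mul_le_mul hπ1 (mul_le_mul_of_nonneg_left (h1 h0) hc) (mul_nonneg hc (abs_nonneg _)) zero_le_one
      _ = |c| * CV * K₁ * t := by ring
  have t2 : |c * W * π'| ≤ |c| * CV * K₁ * t := by
    by_cases h0 : π' = 0
    · rw [h0, mul_zero, abs_zero]; exact n1
    rw [abs_mul, abs_mul]
    calc |c| * |W| * |π'| ≤ |c| * (CV * (K₁ * t)) * 1 :=
          mul_le_mul (mul_le_mul_of_nonneg_left (h2 h0) hc) hπ'1 (abs_nonneg _) (mul_nonneg hc (mul_nonneg hCV (mul_nonneg hK₁ ht)))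
      _ = |c| * CV * K₁ * t := by ring
  have t3 : |c * Q * π * π'| ≤ |c| * CQ * K₂ * t := by
    by_cases h0 : π = 0
    · rw [h0, mul_zero, zero_mul, abs_zero]; exact n3
    by_cases h0' : π' = 0
    · rw [h0', mul_zero, abs_zero]; exact n3
    rw [abs_mul, abs_mul, abs_mul]
    have hq : 0 ≤ |c| * (CQ * (K₂ * t)) := mul_nonneg hc (mul_nonneg hCQ (mul_nonneg hK₂ ht))
    calc |c| * |Q| * |π| * |π'| ≤ |c| * (CQ * (K₂ * t)) * 1 * 1 :=
          mul_le_mul (mul_le_mul (mul_le_mul_of_nonneg_left (h3 h0 h0') hc) hπ1 (abs_nonneg _) hq) hπ'1 (abs_nonneg _)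
            (by rw [mul_one]; exact hq)
      _ = |c| * CQ * K₂ * t := by ring
  have a1 := abs_sub (π * (c * W') + c * W * π') (c * Q * π * π')
  have a2 := abs_add_le (π * (c * W')) (c * W * π')
  rw [abs_mul, abs_of_nonneg hL4]
  have hsum : |π * (c * W') + c * W * π' - c * Q * π * π'| ≤ |c| * (2 * CV + CQ) * K₂ * t := by
    nlinarith [mul_nonneg (mul_nonneg hc hCV) ht]
  calc L4 * |π * (c * W') + c * W * π' - c * Q * π * π'| ≤ L4 * (|c| * (2 * CV + CQ) * K₂ * t) := mul_le_mul_of_nonneg_left hsum hL4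
    _ = L4 * |c| * (2 * CV + CQ) * K₂ * t := by ring

/-- [folklore] **THE WARD MODEL IS A `LocStencil₂` FAMILY** (the END's `hB`; in-block root, `Lc ≥ 1`, rate `1∕8`): on the support of the entry
flux both jet bonds lie within `2|z − x|₁ + 5|ρ|₁` of `x`, `vhSAt` is a local stencil (`locStencil_vhSAt`, rate `1`) and the charge kernel decays
(rate `9∕8`); the triangle inequality trades the three localisations for `e^{−(|u′−u|₁ + |x−u|₁ + |z−u|₁)∕8}`. -/
theorem locStencil₂_TB (hLc : 1 ≤ Lc) {r : Fin (3 + 1) → ℕ} (hr : r ∈ box (3 + 1) Lc) (c' : ℝ) :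
    ∃ C δ : ℝ, 0 < δ ∧ LocStencil₂ (TB (toSite r) Lc c') C δ := by
  have hR0nn : 0 ≤ l1 (toSite r : Fin (3 + 1) → ℤ) := l1_nonneg _
  -- the classes of the letters
  have hCV0 : (0 : ℝ) ≤ 3 * (AveragingHessianKernels.ell (3 + 1) Lc : ℝ) ^ 2 * Real.exp (4 * ((3 : ℝ) + 1) * Lc * 1) := by positivity
  have hV : LocStencil (vhSAt (toSite r) 3 Lc) (3 * (AveragingHessianKernels.ell (3 + 1) Lc : ℝ) ^ 2 * Real.exp (4 * ((3 : ℝ) + 1) * Lc * 1)) 1 :=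
    locStencil_vhSAt (d := 3) hLc hr zero_le_one
  have hCQ0 : (0 : ℝ) ≤ cBHA 3 Lc * Real.exp ((9 / 8 : ℝ) * (((3 : ℝ) + 1) * (2 * Lc))) :=
    mul_nonneg (cBHA_nonneg 3 Lc) (Real.exp_pos _).le
  refine ⟨(Lc : ℝ) ^ 4 / 2 * |c'| *
      (2 * (3 * (AveragingHessianKernels.ell (3 + 1) Lc : ℝ) ^ 2 * Real.exp (4 * ((3 : ℝ) + 1) * Lc * 1)) +
        cBHA 3 Lc * Real.exp ((9 / 8 : ℝ) * (((3 : ℝ) + 1) * (2 * Lc)))) *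
      Real.exp (5 * l1 (toSite r : Fin (3 + 1) → ℤ) / 2), 1 / 8, by norm_num, ?_⟩
  intro κ u κ' u' x z a b
  rw [TB_apply]
  -- geometry of the entry
  have hD : l1 (z - x) ≤ l1 (x - u) + l1 (z - u) := by
    have := l1_sub_triangle z u x; rw [l1_sub_symm u x] at this; linarith
  have n1 := l1_nonneg (x - u); have n2 := l1_nonneg (z - u); have n3 := l1_nonneg (u' - u)
  have n4 := l1_nonneg (x - u'); have n5 := l1_nonneg (z - u'); have n6 := l1_nonneg (z - x)
  -- the target exponential, split as the class wants it
  have hexpT : Real.exp (-(1 / 8 : ℝ) * (l1 (u' - u) + (l1 (x - u) + l1 (z - u)))) =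
      Real.exp (-(1 / 8) * l1 (u' - u)) * Real.exp (-(1 / 8) * (l1 (x - u) + l1 (z - u))) := by
    rw [← Real.exp_add]; congr 1; ring
  have key := entry_bound (c := c') (W := vhSAt (toSite r) 3 Lc rfl κ u x z a b) (W' := vhSAt (toSite r) 3 Lc rfl κ' u' x z a b)
    (Q := mfNeg (linSymAt (toSite r) Lc) x z a b) (hL4 := (by positivity : (0 : ℝ) ≤ (Lc : ℝ) ^ 4 / 2)) hCV0 hCQ0
    (Real.exp_le_exp.2 (by linarith : 15 * l1 (toSite r : Fin (3 + 1) → ℤ) / 8 ≤ 5 * l1 (toSite r : Fin (3 + 1) → ℤ) / 2))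
    (Real.exp_pos _).le (Real.exp_pos (-(1 / 8 : ℝ) * (l1 (u' - u) + (l1 (x - u) + l1 (z - u))))).le
    (abs_spath_le (legSite (toSite r) x a) (legSite (toSite r) z b) κ u)
    (abs_spath_le (legSite (toSite r) x a) (legSite (toSite r) z b) κ' u') ?_ ?_ ?_
  · rw [hexpT] at key
    simpa only [mul_assoc] using key
  · -- term 1: flux in the first slot ⇒ `u` near `x`; the second-slot table localises `x, z` at `u'`
    intro h0
    have hu : l1 (u - x) ≤ 2 * l1 (z - x) + 5 * l1 (toSite r : Fin (3 + 1) → ℤ) := l1_sub_le_of_spath_ne_zero h0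
    have hD' : l1 (z - x) ≤ l1 (x - u') + l1 (z - u') := by
      have := l1_sub_triangle z u' x; rw [l1_sub_symm u' x] at this; linarith
    have e1 : l1 (x - u) ≤ 2 * (l1 (x - u') + l1 (z - u')) + 5 * l1 (toSite r : Fin (3 + 1) → ℤ) := by
      rw [l1_sub_symm x u]; linarith
    have e2 : l1 (z - u) ≤ 3 * (l1 (x - u') + l1 (z - u')) + 5 * l1 (toSite r : Fin (3 + 1) → ℤ) := by
      have := l1_sub_triangle z x u; linarith
    have e3 : l1 (u' - u) ≤ 3 * (l1 (x - u') + l1 (z - u')) + 5 * l1 (toSite r : Fin (3 + 1) → ℤ) := by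
      have := l1_sub_triangle u' x u; rw [l1_sub_symm u' x] at this; linarith
    refine (hV κ' u' x z a b).trans (mul_le_mul_of_nonneg_left ?_ hCV0)
    rw [← Real.exp_add]; exact Real.exp_le_exp.2 (by linarith)
  · -- term 2: flux in the second slot ⇒ `u'` near `x`; the first-slot table localises `x, z` at `u`
    intro h0
    have hu : l1 (u' - x) ≤ 2 * l1 (z - x) + 5 * l1 (toSite r : Fin (3 + 1) → ℤ) := l1_sub_le_of_spath_ne_zero h0
    have e3 : l1 (u' - u) ≤ 3 * (l1 (x - u) + l1 (z - u)) + 5 * l1 (toSite r : Fin (3 + 1) → ℤ) := by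
      have := l1_sub_triangle u' x u; linarith
    refine (hV κ u x z a b).trans (mul_le_mul_of_nonneg_left ?_ hCV0)
    rw [← Real.exp_add]; exact Real.exp_le_exp.2 (by linarith)
  · -- term 3: both fluxes ⇒ `u, u'` near `x`; the charge kernel localises `z` at `x`
    intro h0 h0'
    have hu : l1 (u - x) ≤ 2 * l1 (z - x) + 5 * l1 (toSite r : Fin (3 + 1) → ℤ) := l1_sub_le_of_spath_ne_zero h0
    have hu' : l1 (u' - x) ≤ 2 * l1 (z - x) + 5 * l1 (toSite r : Fin (3 + 1) → ℤ) := l1_sub_le_of_spath_ne_zero h0'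
    have e1 : l1 (x - u) ≤ 2 * l1 (z - x) + 5 * l1 (toSite r : Fin (3 + 1) → ℤ) := by rw [l1_sub_symm x u]; exact hu
    have e2 : l1 (z - u) ≤ 3 * l1 (z - x) + 5 * l1 (toSite r : Fin (3 + 1) → ℤ) := by
      have := l1_sub_triangle z x u; linarith
    have e3 : l1 (u' - u) ≤ 4 * l1 (z - x) + 10 * l1 (toSite r : Fin (3 + 1) → ℤ) := by
      have := l1_sub_triangle u' x u; linarith
    refine (abs_mfNeg_linSymAt_le hLc hr (by norm_num : (0 : ℝ) ≤ 9 / 8) x z a b).trans (mul_le_mul_of_nonneg_left ?_ hCQ0)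
    rw [← Real.exp_add, l1_sub_symm x z]; exact Real.exp_le_exp.2 (by linarith)

end Class

end Summit.QuantumFields.BalabanUV.Beta.WardBorderWardModelClass

end
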